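import Literature.Geometry.Kaehler.ComplexTorusLefschetzSL2ActionCharacterClosedForm
import Literature.Geometry.Kaehler.ComplexTorusWeilWeylOperatorEigenvalueMultiplicities
import Literature.Algebra.Lie.LefschetzModuleWeylOperatorDegreeZero
import HarnessLib

/-!
# The Weyl operator on the middle cohomology `Hᵍ(X; ℂ)` of a complex torus: an involution of trace `2^g` whose
# `(+1)`- and `(−1)`-eigenspaces are the Lefschetz summands `Lᵐ P^{g−2m}` with `m` even, resp. odd, of dimensions `(C(2g, g) ± 2^g)/2`

[topic Geometry/Kaehler]

Layer `Literature/Geometry/Kaehler`, namespace `Literature.Geometry.Kaehler.ComplexTorus`; lane `lit-hodgefound` (Track 2 foundations library),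
prover seat `lit-hodgefound-p09` (generation 56, row g56-#2).  THEOREMS ONLY (no definition, no named fact, no instance, no notation; D-0026 net
debt `0`).  The carrier reading of the seat's abstract `Algebra/Lie/LefschetzModuleWeylOperatorDegreeZero` (g56-#1: `tr(w | M₀) = tr w`,
`w² = 1` on `M₀`, `M₀ ∩ ker(w ∓ 1) = ⨆_{m even / odd} eᵐP_{−2m}`, `2 dim = dim M₀ ± tr w`) on `H•(X; ℂ) = GForm E ℂ` of a complex torus
`X = E/Λ` of dimension `g`, where the Lefschetz grading is `h = countingG E` (`Hᵏ(X)` in degree `k − g`, so that DEGREE `0` IS THE MIDDLE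
COHOMOLOGY `Hᵍ(X; ℂ)`), `e = L_η = lefschetzG η` for a non-degenerate real `2`-form `η` (`hη`), and `w` is the Weyl element of the Lefschetz
`SL₂` (Beauville's `(0 −1 ; 1 0) · z = ℱ(z)`, the Fourier transform), CONSUMED BY NAME together with `trace_weylOperator` (`tr w = 2^g`,
`ComplexTorusLefschetzSL2ActionCharacterClosedForm`), `finrank_degreeSpace_countingG` (`dim Hᵏ = C(2g, k)`), `primitiveSpace_countingG_eq_map`
(`P_{−n} = P^{g−n}(η)` placed in degree `g − n`), `lefschetzG_pow_of` and `lefschetzSummandForms` (`Lˢ P^{k−2s} ⊂ Hᵏ`), and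
`finrank_eigenspace_weylOperator_one` / `_neg_one` (`4^{g−1} ± 2^{g−1}`, `ComplexTorusWeilWeylOperatorEigenvalueMultiplicities`).

## Sources, VERBATIM

* A. Beauville, *The action of SL₂ on abelian varieties*, J. Ramanujan Math. Soc. 25 (2010) [Beauville2010SL2] (held `paper:arxiv-0805.1541`),
  §4 Theorem (p0005): "`(0 −1 ; 1 0) · z = ℱ(z)`"; §5 (p0006 L13–L16): "**Corollary.** Let `P^p_s ⊂ CH^p_s(A)` be the subspace of primitive
  elements. Then `CH^p_s(A) = ⊕_{q≤p} θ^{p−q} P^q_s`. Since the Fourier automorphism `ℱ` of `CH(A)` is given by the action of `w`, we have: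
  **Corollary.** Let `z ∈ CH^p_s(A)` be a primitive element, and let `q ≤ g+s−2p`. Then `ℱ(θ^q z / q!) = ((−θ)^r / r!) z`, with
  `r = g+s−2p−q`." — in cohomology (`s = 0`) with `q = r = m`, `p = g − m`: on the middle summand `θᵐ P^{g−2m} ⊂ Hᵍ` the Fourier transform
  is the scalar `(−1)^m`; §3 Proposition (ii) (p0004 L16): "`h² = (β(u) h)³ = β(−I)`" — `w² = (−1_A)^*[−g]`, the identity on `Hᵍ`.
* H. Lange, *Abelian Varieties over the Complex Numbers* (2023) [Lange2023AbelianVarietiesComplex], §7.3.2 (3): "`⋀ᵏ V = Pᵏ ⊕ L P^{k−2} ⊕ L² P^{k−4}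
  ⊕ ⋯`" (the Lefschetz summands `Lᵐ P^{k−2m}`, the tree's `lefschetzSummandForms η k m`), `dim Pᵏ = C(2g, k) − C(2g, k−2)`; §1.1.3 Cor. 1.1.19
  (`dim Hᵏ(X, ℂ) = C(2g, k)`).
* Th. Bröcker, T. tom Dieck, *Representations of Compact Lie Groups*, GTM 98 (1985) [BrockerTomDieck1985] (held, II §5 p0080): "The character
  `χ_n` of `V_n` has the value `Σ_{k=0}^{n} e^{i(n−2k)t}` at `e(t)`." and "`−E` acts as multiplication by `(−1)^n` on `V_n`" (the zero weight
  vector of `V_{2m}` is a `w`-eigenvector with eigenvalue `(−1)^m`; `w² = +1` on the zero weight space).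
* J.-P. Serre, *Linear Representations of Finite Groups* (1977) [Serre1977], §2.6 Thm. 8 (ii) and Exercise 2.8 (a) (multiplicities from traces:
  `2 dim ker(T ∓ 1) = dim ± tr T` for an involution `T`).

## What is proved (`g = finrank ℂ E ≥ 1`, `Hᵍ = degreeSpace (countingG E) 0 = range (single g)`,
`w = (hasLefschetzProperty_lefschetzG hη).weylOperator isZGrading_countingG`, `P_{−n} = HasLefschetzProperty.primitiveSpace (countingG E) (lefschetzG η) n`)

* §1 `degreeSpace_countingG_zero_eq_range_single` (`Hᵍ` is the degree-`0` piece), `of_finrank_mem_degreeSpace_countingG_zero`,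
  `finrank_degreeSpace_countingG_zero` (`dim Hᵍ = C(2g, g)`).
* §2 `weylOperator_weylOperator_apply_of_mem_degreeSpace_countingG_zero`, `weylOperator_weylOperator_of_finrank` (`w² = 1` on `Hᵍ`),
  **`trace_weylOperator_restrict_degreeSpace_countingG_zero`** — `tr(w | Hᵍ) = 2^g` (= `tr w`: the whole trace of the Weyl element sits in
  the middle degree).
* §3 (the middle Lefschetz summands in the abstract language) `map_pow_lefschetzG_primitiveSpace_eq_map_single` (`L^i P_{−k} = single n (Lⁱ P^{g−k}(η))`,
  `2i + (g − k) = n`), `map_pow_lefschetzG_primitiveSpace_two_mul_eq` (`Lᵐ P_{−2m} = single g (Lᵐ P^{g−2m})`, `2m ≤ g`),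
  `map_pow_lefschetzG_primitiveSpace_two_mul_eq_bot` (`2m > g`), `biSup_map_pow_lefschetzG_primitiveSpace_two_mul_eq` (only `m ≤ g/2` matter).
* §4 **`degreeSpace_countingG_zero_inf_eigenspace_weylOperator_one`** — `Hᵍ ∩ ker(w − 1) = ⨆_{m ≤ g/2, m even} single g (Lᵐ P^{g−2m})`,
  **`degreeSpace_countingG_zero_inf_eigenspace_weylOperator_neg_one`** (`m` odd), and the FORMS-LEVEL statements
  **`comap_single_eigenspace_weylOperator_one`** — `{α ∈ Altᵍ : w(of g α) = of g α} = ⨆_{m ≤ g/2, m even} Lᵐ P^{g−2m}(η)`,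
  **`comap_single_eigenspace_weylOperator_neg_one`** (`w(of g α) = −of g α` iff `α ∈ ⨆_{m odd} Lᵐ P^{g−2m}`),
  `degreeSpace_countingG_zero_inf_eigenspace_weylOperator_eq_bot_of_sq_eq_neg_one`, `eq_zero_of_weylOperator_of_finrank_eq_smul`
  (no middle class is a `±i`-eigenvector).
* §5 (dimensions) `finrank_degreeSpace_countingG_zero_inf_eigenspace_weylOperator_one_eq_sum` (`= Σ_{m ≤ g/2, m even} dim P^{g−2m}(η)`),
  `…_neg_one_eq_sum`, **`two_mul_finrank_degreeSpace_countingG_zero_inf_eigenspace_weylOperator_one`** (`2 dim (Hᵍ ∩ ker(w − 1)) = C(2g, g) + 2^g`),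
  **`two_mul_finrank_degreeSpace_countingG_zero_inf_eigenspace_weylOperator_neg_one`** (`2 dim (Hᵍ ∩ ker(w + 1)) + 2^g = C(2g, g)`),
  `finrank_degreeSpace_countingG_zero_inf_eigenspace_weylOperator_one_add_neg_one` (`= C(2g, g)`), `pow_le_choose_of_weylOperator`
  (`2^g ≤ C(2g, g)`, read off `w`), and OFF THE MIDDLE DEGREE the two real eigenvalues balance:
  `finrank_eigenspace_weylOperator_one_add_eq` (`dim ker(w − 1) + dim (Hᵍ ∩ ker(w + 1)) = dim ker(w + 1) + dim (Hᵍ ∩ ker(w − 1))`).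

## SCOPE

(a) `η` is any non-degenerate real `2`-form (no type `(1,1)` or positivity assumption); the Hodge-type refinement of the `±1`-eigenspaces in
`Hᵍ` is the seat's `ComplexTorusWeylOperatorWeightSpaceSpectrum` (weight `d = p − q`, here intersected with the degree).  (b) Forms carrier
only (`H•(X; ℂ) = GForm E ℂ`); no lattice / rationality statement.  (c) HC is not touched; foundations-library row.
-/

noncomputable section

namespace Literature.Geometry.Kaehler

namespace ComplexTorus

-- `_root_.Complex`: the import closure declares a namespace `…ComplexTorus.Complex`; be explicit.
open Module Function Finset _root_.Complex
open Literature.LinearAlgebra Literature.LinearAlgebra.Alternating Literature.Algebra.Lie Literature.Analysis.Complex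

universe uE

variable {E : Type uE} [NormedAddCommGroup E] [NormedSpace ℂ E] [FiniteDimensional ℂ E] [Nontrivial E] {η : E [⋀^Fin 2]→L[ℝ] ℝ}

/-! ## §1 The middle cohomology `Hᵍ(X; ℂ)` is the degree-`0` piece of the Lefschetz grading -/

omit [FiniteDimensional ℂ E] [Nontrivial E] in
/-- **`M₀ = Hᵍ(X; ℂ)`**: the degree-`0` piece of `(H•(X; ℂ), h)` is the range of `single g : Altᵍ → H•` (`h = (k − g)` on `Hᵏ`).
[cite: HuybrechtsCG2005, §1.2 Def. 1.2.25 (the counting operator)] [cite: Beauville2010SL2, §4 Theorem ("h · z = (2p − g − s) z")] -/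
theorem degreeSpace_countingG_zero_eq_range_single :
    degreeSpace (countingG E) 0 = LinearMap.range (LinearMap.single ℂ (fun m : ℕ ↦ E [⋀^Fin m]→L[ℝ] ℂ) (finrank ℂ E)) := by
  have h1 := degreeSpace_countingG_eq_range_single (E := E) (finrank ℂ E)
  rwa [sub_self] at h1

omit [FiniteDimensional ℂ E] [Nontrivial E] in
/-- A middle-degree form is a class of degree `0`. [cite: HuybrechtsCG2005, §1.2 Def. 1.2.25] -/
theorem of_finrank_mem_degreeSpace_countingG_zero (α : E [⋀^Fin (finrank ℂ E)]→L[ℝ] ℂ) :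
    GForm.of (finrank ℂ E) α ∈ degreeSpace (countingG E) 0 := by
  have h1 := of_mem_degreeSpace_countingG (E := E) (finrank ℂ E) α
  rwa [sub_self] at h1

omit [Nontrivial E] in
/-- **`dim Hᵍ(X; ℂ) = C(2g, g)`.** [cite: Lange2023AbelianVarietiesComplex, §1.1.3 Cor. 1.1.19] -/
theorem finrank_degreeSpace_countingG_zero : finrank ℂ ↥(degreeSpace (countingG E) 0) = (2 * finrank ℂ E).choose (finrank ℂ E) := by
  have h1 := finrank_degreeSpace_countingG (E := E) (finrank ℂ E)
  rwa [sub_self] at h1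

/-! ## §2 `w` is an involution of `Hᵍ(X; ℂ)` of trace `2^g` -/

/-- **`w² = 1` on `Hᵍ(X; ℂ)`** (`w² = (−1_A)^*[−g]` acts by `(−1)^{k−g}` on `Hᵏ`). [cite: Beauville2010SL2, §3 Proposition (ii) ("h² = (β(u)h)³ = β(−I)")]
[cite: BrockerTomDieck1985, II §5 (p0080, "−E acts as multiplication by (−1)^n on V_n")] -/
theorem weylOperator_weylOperator_apply_of_mem_degreeSpace_countingG_zero (hη : ∀ v : E, v ≠ 0 → ∃ w : E, η ![v, w] ≠ 0) {x : GForm E ℂ}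
    (hx : x ∈ degreeSpace (countingG E) 0) :
    (hasLefschetzProperty_lefschetzG hη).weylOperator isZGrading_countingG
      ((hasLefschetzProperty_lefschetzG hη).weylOperator isZGrading_countingG x) = x :=
  (hasLefschetzProperty_lefschetzG hη).weylOperator_weylOperator_apply_of_mem_degreeSpace_zero isZGrading_countingG hx

/-- `w(w(of g α)) = of g α` for every middle-degree form `α`. [cite: Beauville2010SL2, §3 Proposition (ii)] -/
theorem weylOperator_weylOperator_of_finrank (hη : ∀ v : E, v ≠ 0 → ∃ w : E, η ![v, w] ≠ 0) (α : E [⋀^Fin (finrank ℂ E)]→L[ℝ] ℂ) :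
    (hasLefschetzProperty_lefschetzG hη).weylOperator isZGrading_countingG
      ((hasLefschetzProperty_lefschetzG hη).weylOperator isZGrading_countingG (GForm.of (finrank ℂ E) α)) = GForm.of (finrank ℂ E) α :=
  weylOperator_weylOperator_apply_of_mem_degreeSpace_countingG_zero hη (of_finrank_mem_degreeSpace_countingG_zero α)

/-- **`tr(w | Hᵍ(X; ℂ)) = 2^g`**: the trace of the Weyl element (`tr w = 2^g`, `trace_weylOperator`) is carried by the middle degree alone
(`w(Hᵏ) ⊆ H^{2g−k}`). [cite: Beauville2010SL2, §3 Theorem and §4 Theorem ("(0 −1 ; 1 0)·z = ℱ(z)")] [cite: Serre1977, §2.1 Exercise 2.2] -/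
theorem trace_weylOperator_restrict_degreeSpace_countingG_zero (hη : ∀ v : E, v ≠ 0 → ∃ w : E, η ![v, w] ≠ 0) :
    LinearMap.trace ℂ ↥(degreeSpace (countingG E) 0) (((hasLefschetzProperty_lefschetzG hη).weylOperator isZGrading_countingG).restrict
      ((hasLefschetzProperty_lefschetzG hη).weylOperator_mapsTo_degreeSpace_zero isZGrading_countingG)) = (2 : ℂ) ^ finrank ℂ E := by
  rw [(hasLefschetzProperty_lefschetzG hη).trace_weylOperator_restrict_degreeSpace_zero isZGrading_countingG, trace_weylOperator hη]

/-! ## §3 The middle Lefschetz summands `Lᵐ P^{g−2m}` in the abstract language: `Lᵐ P_{−2m} = single g (Lᵐ P^{g−2m}(η))` -/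

/-- **`Lⁱ P_{−k} = single n (Lⁱ P^{g−k}(η))`** for `k ≤ g` and `2i + (g − k) = n`: the abstract block `eⁱP_{−k}` of the primitive decomposition of
`(H•(X; ℂ), h, L_η)` is Lange's Lefschetz summand `Lⁱ P^{g−k} ⊂ Hⁿ` placed in degree `n`. [cite: Lange2023AbelianVarietiesComplex, §7.3.2 (3) ("⋀ᵏ V = Pᵏ ⊕ L P^{k−2} ⊕ ⋯")]
[cite: Beauville2010SL2, §5 Corollary ("CH^p_s(A) = ⊕_{q≤p} θ^{p−q} P^q_s")] -/
theorem map_pow_lefschetzG_primitiveSpace_eq_map_single (hη : ∀ v : E, v ≠ 0 → ∃ w : E, η ![v, w] ≠ 0) {k i n : ℕ} (hk : k ≤ finrank ℂ E)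
    (h : 2 * i + (finrank ℂ E - k) = n) :
    (HasLefschetzProperty.primitiveSpace (countingG E) (lefschetzG η) k).map (lefschetzG η ^ i) =
      (lefschetzSummandForms η n i).map (LinearMap.single ℂ (fun m : ℕ ↦ E [⋀^Fin m]→L[ℝ] ℂ) n) := by
  have hcomp : (lefschetzG η ^ i) ∘ₗ LinearMap.single ℂ (fun m : ℕ ↦ E [⋀^Fin m]→L[ℝ] ℂ) (finrank ℂ E - k) =
      LinearMap.single ℂ (fun m : ℕ ↦ E [⋀^Fin m]→L[ℝ] ℂ) n ∘ₗ lefschetzPow η i h :=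
    LinearMap.ext fun α ↦ lefschetzG_pow_of η i h α
  rw [primitiveSpace_countingG_eq_map hη hk, ← Submodule.map_comp, hcomp, Submodule.map_comp, lefschetzSummandForms_eq η h]

/-- **`Lᵐ P_{−2m} = single g (Lᵐ P^{g−2m}(η))`** (`2m ≤ g`): the middles of the strings of odd length are the Lefschetz summands of `Hᵍ`.
[cite: Lange2023AbelianVarietiesComplex, §7.3.2 (3)] [cite: Beauville2010SL2, §5 Corollary] -/
theorem map_pow_lefschetzG_primitiveSpace_two_mul_eq (hη : ∀ v : E, v ≠ 0 → ∃ w : E, η ![v, w] ≠ 0) {m : ℕ} (hm : 2 * m ≤ finrank ℂ E) :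
    (HasLefschetzProperty.primitiveSpace (countingG E) (lefschetzG η) (2 * m)).map (lefschetzG η ^ m) =
      (lefschetzSummandForms η (finrank ℂ E) m).map (LinearMap.single ℂ (fun m : ℕ ↦ E [⋀^Fin m]→L[ℝ] ℂ) (finrank ℂ E)) :=
  map_pow_lefschetzG_primitiveSpace_eq_map_single hη hm (by omega)

omit [FiniteDimensional ℂ E] [Nontrivial E] in
/-- `Lᵐ P_{−2m} = 0` for `2m > g` (no strings start below degree `−g`). [cite: Beauville2010SL2, §5 Proposition ("g + s − 2p ≥ 0")] -/
theorem map_pow_lefschetzG_primitiveSpace_two_mul_eq_bot {m : ℕ} (hm : finrank ℂ E < 2 * m) :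
    (HasLefschetzProperty.primitiveSpace (countingG E) (lefschetzG η) (2 * m)).map (lefschetzG η ^ m) = ⊥ := by
  rw [primitiveSpace_eq_bot_of_lt hm, Submodule.map_bot]

/-- Only `m ≤ g/2` matter: `⨆_{p m} Lᵐ P_{−2m} = ⨆_{m ≤ g/2, p m} single g (Lᵐ P^{g−2m}(η))` for any predicate `p`.
[cite: Lange2023AbelianVarietiesComplex, §7.3.2 (3)] [cite: Beauville2010SL2, §5 Corollary] -/
theorem biSup_map_pow_lefschetzG_primitiveSpace_two_mul_eq (hη : ∀ v : E, v ≠ 0 → ∃ w : E, η ![v, w] ≠ 0) (p : ℕ → Prop) [DecidablePred p] :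
    ⨆ (m : ℕ) (_ : p m), (HasLefschetzProperty.primitiveSpace (countingG E) (lefschetzG η) (2 * m)).map (lefschetzG η ^ m) =
      ⨆ m ∈ (range (finrank ℂ E / 2 + 1)).filter p,
        (lefschetzSummandForms η (finrank ℂ E) m).map (LinearMap.single ℂ (fun m : ℕ ↦ E [⋀^Fin m]→L[ℝ] ℂ) (finrank ℂ E)) := by
  refine le_antisymm (iSup₂_le fun m hm ↦ ?_) (iSup₂_le fun m hm ↦ ?_)
  · by_cases hmg : 2 * m ≤ finrank ℂ E
    · rw [map_pow_lefschetzG_primitiveSpace_two_mul_eq hη hmg]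
      exact le_iSup₂_of_le m (mem_filter.2 ⟨mem_range.2 (by omega), hm⟩) le_rfl
    · rw [map_pow_lefschetzG_primitiveSpace_two_mul_eq_bot (not_le.1 hmg)]
      exact bot_le
  · have hm' := mem_filter.1 hm
    rw [← map_pow_lefschetzG_primitiveSpace_two_mul_eq hη (by have := mem_range.1 hm'.1; omega)]
    exact le_iSup₂_of_le m hm'.2 le_rfl

/-! ## §4 The `±1`-eigenspaces of `w` in the middle degree are the even / odd Lefschetz summands -/

/-- **`Hᵍ ∩ ker(w − 1) = ⊕_{m ≤ g/2, m even} Lᵐ P^{g−2m}`**: a middle class is FIXED by the Weyl element (the Fourier transform) iff it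
lies in the Lefschetz summands `Lᵐ P^{g−2m}` with `m` even ("`ℱ(θ^q z/q!) = ((−θ)^r/r!) z`", `q = r = m`: `ℱ = (−1)^m` on `θᵐ P^{g−2m}`).
[cite: Beauville2010SL2, §5 Corollary] [cite: Lange2023AbelianVarietiesComplex, §7.3.2 (3)] [cite: BrockerTomDieck1985, II §5 (p0080)] -/
theorem degreeSpace_countingG_zero_inf_eigenspace_weylOperator_one (hη : ∀ v : E, v ≠ 0 → ∃ w : E, η ![v, w] ≠ 0) :
    degreeSpace (countingG E) 0 ⊓ Module.End.eigenspace ((hasLefschetzProperty_lefschetzG hη).weylOperator isZGrading_countingG) 1 =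
      ⨆ m ∈ (range (finrank ℂ E / 2 + 1)).filter Even,
        (lefschetzSummandForms η (finrank ℂ E) m).map (LinearMap.single ℂ (fun m : ℕ ↦ E [⋀^Fin m]→L[ℝ] ℂ) (finrank ℂ E)) := by
  rw [(hasLefschetzProperty_lefschetzG hη).degreeSpace_zero_inf_eigenspace_weylOperator_one isZGrading_countingG,
    biSup_map_pow_lefschetzG_primitiveSpace_two_mul_eq hη]

/-- **`Hᵍ ∩ ker(w + 1) = ⊕_{m ≤ g/2, m odd} Lᵐ P^{g−2m}`**: the middle classes REVERSED by the Weyl element.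
[cite: Beauville2010SL2, §5 Corollary] [cite: Lange2023AbelianVarietiesComplex, §7.3.2 (3)] [cite: BrockerTomDieck1985, II §5 (p0080)] -/
theorem degreeSpace_countingG_zero_inf_eigenspace_weylOperator_neg_one (hη : ∀ v : E, v ≠ 0 → ∃ w : E, η ![v, w] ≠ 0) :
    degreeSpace (countingG E) 0 ⊓ Module.End.eigenspace ((hasLefschetzProperty_lefschetzG hη).weylOperator isZGrading_countingG) (-1) =
      ⨆ m ∈ (range (finrank ℂ E / 2 + 1)).filter Odd,
        (lefschetzSummandForms η (finrank ℂ E) m).map (LinearMap.single ℂ (fun m : ℕ ↦ E [⋀^Fin m]→L[ℝ] ℂ) (finrank ℂ E)) := by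
  rw [(hasLefschetzProperty_lefschetzG hη).degreeSpace_zero_inf_eigenspace_weylOperator_neg_one isZGrading_countingG,
    biSup_map_pow_lefschetzG_primitiveSpace_two_mul_eq hη]

omit [FiniteDimensional ℂ E] [Nontrivial E] in
/-- Pulling a middle-degree statement back to `Altᵍ`: `single g ⁻¹ (Hᵍ ∩ S) = single g ⁻¹ S`. [folklore] -/
private theorem comap_single_degreeSpace_zero_inf₅₈ (S : Submodule ℂ (GForm E ℂ)) :
    (degreeSpace (countingG E) 0 ⊓ S).comap (LinearMap.single ℂ (fun m : ℕ ↦ E [⋀^Fin m]→L[ℝ] ℂ) (finrank ℂ E)) =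
      S.comap (LinearMap.single ℂ (fun m : ℕ ↦ E [⋀^Fin m]→L[ℝ] ℂ) (finrank ℂ E)) := by
  have h1 : (degreeSpace (countingG E) 0).comap (LinearMap.single ℂ (fun m : ℕ ↦ E [⋀^Fin m]→L[ℝ] ℂ) (finrank ℂ E)) = ⊤ :=
    eq_top_iff.2 fun α _ ↦ of_finrank_mem_degreeSpace_countingG_zero α
  rw [Submodule.comap_inf, h1, top_inf_eq]

omit [FiniteDimensional ℂ E] [Nontrivial E] in
/-- `single g ⁻¹ (⨆_{m ∈ s} single g (T m)) = ⨆_{m ∈ s} T m` (`single g` is injective). [folklore] -/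
private theorem comap_single_biSup_map₅₈ (s : Finset ℕ) (T : ℕ → Submodule ℂ (E [⋀^Fin (finrank ℂ E)]→L[ℝ] ℂ)) :
    (⨆ m ∈ s, (T m).map (LinearMap.single ℂ (fun m : ℕ ↦ E [⋀^Fin m]→L[ℝ] ℂ) (finrank ℂ E))).comap
        (LinearMap.single ℂ (fun m : ℕ ↦ E [⋀^Fin m]→L[ℝ] ℂ) (finrank ℂ E)) = ⨆ m ∈ s, T m := by
  have h1 : (⨆ m ∈ s, (T m).map (LinearMap.single ℂ (fun m : ℕ ↦ E [⋀^Fin m]→L[ℝ] ℂ) (finrank ℂ E))) =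
      (⨆ m ∈ s, T m).map (LinearMap.single ℂ (fun m : ℕ ↦ E [⋀^Fin m]→L[ℝ] ℂ) (finrank ℂ E)) := by
    simp_rw [Submodule.map_iSup]
  rw [h1, Submodule.comap_map_eq_of_injective (fun a b hab ↦ GForm.of_injective (V := E) (F := ℂ) (finrank ℂ E) hab)]

/-- **THE MIDDLE-DEGREE FORMS FIXED BY THE WEYL ELEMENT: `{α ∈ Altᵍ : w(of g α) = of g α} = ⊕_{m ≤ g/2, m even} Lᵐ P^{g−2m}(η)`.**
[cite: Beauville2010SL2, §4 Theorem ("(0 −1 ; 1 0)·z = ℱ(z)") and §5 Corollary ("ℱ(θ^q z/q!) = ((−θ)^r/r!) z")] [cite: Lange2023AbelianVarietiesComplex, §7.3.2 (3)] -/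
theorem comap_single_eigenspace_weylOperator_one (hη : ∀ v : E, v ≠ 0 → ∃ w : E, η ![v, w] ≠ 0) :
    (Module.End.eigenspace ((hasLefschetzProperty_lefschetzG hη).weylOperator isZGrading_countingG) 1).comap
        (LinearMap.single ℂ (fun m : ℕ ↦ E [⋀^Fin m]→L[ℝ] ℂ) (finrank ℂ E)) =
      ⨆ m ∈ (range (finrank ℂ E / 2 + 1)).filter Even, lefschetzSummandForms η (finrank ℂ E) m := by
  rw [← comap_single_degreeSpace_zero_inf₅₈, degreeSpace_countingG_zero_inf_eigenspace_weylOperator_one hη, comap_single_biSup_map₅₈]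

/-- **THE MIDDLE-DEGREE FORMS REVERSED BY THE WEYL ELEMENT: `{α ∈ Altᵍ : w(of g α) = −of g α} = ⊕_{m ≤ g/2, m odd} Lᵐ P^{g−2m}(η)`.**
[cite: Beauville2010SL2, §4 Theorem and §5 Corollary] [cite: Lange2023AbelianVarietiesComplex, §7.3.2 (3)] -/
theorem comap_single_eigenspace_weylOperator_neg_one (hη : ∀ v : E, v ≠ 0 → ∃ w : E, η ![v, w] ≠ 0) :
    (Module.End.eigenspace ((hasLefschetzProperty_lefschetzG hη).weylOperator isZGrading_countingG) (-1)).comap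
        (LinearMap.single ℂ (fun m : ℕ ↦ E [⋀^Fin m]→L[ℝ] ℂ) (finrank ℂ E)) =
      ⨆ m ∈ (range (finrank ℂ E / 2 + 1)).filter Odd, lefschetzSummandForms η (finrank ℂ E) m := by
  rw [← comap_single_degreeSpace_zero_inf₅₈, degreeSpace_countingG_zero_inf_eigenspace_weylOperator_neg_one hη, comap_single_biSup_map₅₈]

/-- Membership form: **`w(of g α) = of g α ↔ α ∈ ⊕_{m ≤ g/2, m even} Lᵐ P^{g−2m}(η)`.** [cite: Beauville2010SL2, §4 Theorem and §5 Corollary]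
[cite: Lange2023AbelianVarietiesComplex, §7.3.2 (3)] -/
theorem weylOperator_of_finrank_eq_self_iff (hη : ∀ v : E, v ≠ 0 → ∃ w : E, η ![v, w] ≠ 0) (α : E [⋀^Fin (finrank ℂ E)]→L[ℝ] ℂ) :
    (hasLefschetzProperty_lefschetzG hη).weylOperator isZGrading_countingG (GForm.of (finrank ℂ E) α) = GForm.of (finrank ℂ E) α ↔
      α ∈ ⨆ m ∈ (range (finrank ℂ E / 2 + 1)).filter Even, lefschetzSummandForms η (finrank ℂ E) m := by
  rw [← comap_single_eigenspace_weylOperator_one hη, Submodule.mem_comap, Module.End.mem_eigenspace_iff, one_smul]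
  rfl

/-- Membership form: **`w(of g α) = −of g α ↔ α ∈ ⊕_{m ≤ g/2, m odd} Lᵐ P^{g−2m}(η)`.** [cite: Beauville2010SL2, §4 Theorem and §5 Corollary]
[cite: Lange2023AbelianVarietiesComplex, §7.3.2 (3)] -/
theorem weylOperator_of_finrank_eq_neg_iff (hη : ∀ v : E, v ≠ 0 → ∃ w : E, η ![v, w] ≠ 0) (α : E [⋀^Fin (finrank ℂ E)]→L[ℝ] ℂ) :
    (hasLefschetzProperty_lefschetzG hη).weylOperator isZGrading_countingG (GForm.of (finrank ℂ E) α) = -GForm.of (finrank ℂ E) α ↔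
      α ∈ ⨆ m ∈ (range (finrank ℂ E / 2 + 1)).filter Odd, lefschetzSummandForms η (finrank ℂ E) m := by
  rw [← comap_single_eigenspace_weylOperator_neg_one hη, Submodule.mem_comap, Module.End.mem_eigenspace_iff, neg_one_smul]
  rfl

/-- **No middle class is a `±i`-eigenvector of `w`**: `Hᵍ ∩ ker(w − c) = 0` for `c² = −1` (`w² = +1` on `Hᵍ`).
[cite: Beauville2010SL2, §3 Proposition (ii)] [cite: BrockerTomDieck1985, II §5 (p0080)] -/
theorem degreeSpace_countingG_zero_inf_eigenspace_weylOperator_eq_bot_of_sq_eq_neg_one (hη : ∀ v : E, v ≠ 0 → ∃ w : E, η ![v, w] ≠ 0)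
    {c : ℂ} (hc : c ^ 2 = -1) :
    degreeSpace (countingG E) 0 ⊓ Module.End.eigenspace ((hasLefschetzProperty_lefschetzG hη).weylOperator isZGrading_countingG) c = ⊥ :=
  (hasLefschetzProperty_lefschetzG hη).degreeSpace_zero_inf_eigenspace_weylOperator_eq_bot_of_sq_eq_neg_one isZGrading_countingG hc

/-- `w(of g α) = c • of g α` with `c² = −1` forces `α = 0`. [cite: Beauville2010SL2, §3 Proposition (ii)] -/
theorem eq_zero_of_weylOperator_of_finrank_eq_smul (hη : ∀ v : E, v ≠ 0 → ∃ w : E, η ![v, w] ≠ 0) {c : ℂ} (hc : c ^ 2 = -1)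
    {α : E [⋀^Fin (finrank ℂ E)]→L[ℝ] ℂ}
    (hα : (hasLefschetzProperty_lefschetzG hη).weylOperator isZGrading_countingG (GForm.of (finrank ℂ E) α) = c • GForm.of (finrank ℂ E) α) :
    α = 0 := by
  have h1 : GForm.of (finrank ℂ E) α ∈ degreeSpace (countingG E) 0 ⊓
      Module.End.eigenspace ((hasLefschetzProperty_lefschetzG hη).weylOperator isZGrading_countingG) c :=
    ⟨of_finrank_mem_degreeSpace_countingG_zero α, Module.End.mem_eigenspace_iff.2 hα⟩
  rw [degreeSpace_countingG_zero_inf_eigenspace_weylOperator_eq_bot_of_sq_eq_neg_one hη hc, Submodule.mem_bot] at h1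
  exact GForm.of_eq_zero_iff.1 h1

/-! ## §5 Dimensions: `2 dim (Hᵍ ∩ ker(w ∓ 1)) = C(2g, g) ± 2^g` -/

/-- `range (g/2 + 1) ⊆ range (dim H•(X; ℂ))` (`dim H• = 4^g`, `g ≥ 1`). [folklore] -/
private theorem range_subset_range_finrank_gForm₅₈ : range (finrank ℂ E / 2 + 1) ⊆ range (finrank ℂ (GForm E ℂ)) := by
  intro m hm
  rw [mem_range] at hm ⊢
  rw [finrank_gForm]
  have hg := finrank_pos (R := ℂ) (M := E)
  calc m < finrank ℂ E / 2 + 1 := hm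
    _ ≤ 2 * finrank ℂ E := by omega
    _ ≤ 2 ^ (2 * finrank ℂ E) := Nat.lt_two_pow_self.le

/-- **`dim (Hᵍ ∩ ker(w − 1)) = Σ_{m ≤ g/2, m even} dim P^{g−2m}(η)`** (each summand `Lᵐ P^{g−2m}` has dimension `dim P^{g−2m}`).
[cite: Lange2023AbelianVarietiesComplex, §7.3.2 (3)] [cite: Beauville2010SL2, §5 Proposition and Corollary] -/
theorem finrank_degreeSpace_countingG_zero_inf_eigenspace_weylOperator_one_eq_sum (hη : ∀ v : E, v ≠ 0 → ∃ w : E, η ![v, w] ≠ 0) :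
    finrank ℂ ↥(degreeSpace (countingG E) 0 ⊓ Module.End.eigenspace ((hasLefschetzProperty_lefschetzG hη).weylOperator isZGrading_countingG) 1) =
      ∑ m ∈ (range (finrank ℂ E / 2 + 1)).filter Even, finrank ℂ ↥(primitiveForms η (finrank ℂ E - 2 * m)) := by
  rw [(hasLefschetzProperty_lefschetzG hη).finrank_degreeSpace_zero_inf_eigenspace_weylOperator_one isZGrading_countingG]
  have hsub : (range (finrank ℂ E / 2 + 1)).filter Even ⊆ (range (finrank ℂ (GForm E ℂ))).filter Even :=
    filter_subset_filter _ (range_subset_range_finrank_gForm₅₈ (E := E))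
  rw [← sum_subset hsub fun m hm hm' ↦ finrank_primitiveSpace_countingG_of_lt (η := η)
    (by rw [mem_filter, mem_range, not_and'] at hm'; have := hm' (mem_filter.1 hm).2; omega)]
  exact sum_congr rfl fun m hm ↦ finrank_primitiveSpace_countingG hη (by have := mem_range.1 (mem_filter.1 hm).1; omega)

/-- **`dim (Hᵍ ∩ ker(w + 1)) = Σ_{m ≤ g/2, m odd} dim P^{g−2m}(η)`.** [cite: Lange2023AbelianVarietiesComplex, §7.3.2 (3)]
[cite: Beauville2010SL2, §5 Proposition and Corollary] -/
theorem finrank_degreeSpace_countingG_zero_inf_eigenspace_weylOperator_neg_one_eq_sum (hη : ∀ v : E, v ≠ 0 → ∃ w : E, η ![v, w] ≠ 0) :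
    finrank ℂ ↥(degreeSpace (countingG E) 0 ⊓ Module.End.eigenspace ((hasLefschetzProperty_lefschetzG hη).weylOperator isZGrading_countingG) (-1)) =
      ∑ m ∈ (range (finrank ℂ E / 2 + 1)).filter Odd, finrank ℂ ↥(primitiveForms η (finrank ℂ E - 2 * m)) := by
  rw [(hasLefschetzProperty_lefschetzG hη).finrank_degreeSpace_zero_inf_eigenspace_weylOperator_neg_one isZGrading_countingG]
  have hsub : (range (finrank ℂ E / 2 + 1)).filter Odd ⊆ (range (finrank ℂ (GForm E ℂ))).filter Odd :=
    filter_subset_filter _ (range_subset_range_finrank_gForm₅₈ (E := E))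
  rw [← sum_subset hsub fun m hm hm' ↦ finrank_primitiveSpace_countingG_of_lt (η := η)
    (by rw [mem_filter, mem_range, not_and'] at hm'; have := hm' (mem_filter.1 hm).2; omega)]
  exact sum_congr rfl fun m hm ↦ finrank_primitiveSpace_countingG hη (by have := mem_range.1 (mem_filter.1 hm).1; omega)

/-- **`2 dim (Hᵍ ∩ ker(w − 1)) = C(2g, g) + 2^g`**: the `w`-invariant middle classes (`2 dim = dim Hᵍ + tr(w | Hᵍ)`).
[cite: Serre1977, §2.6 Thm. 8 (ii) and Exercise 2.8 (a)] [cite: Beauville2010SL2, §3 Theorem and §5 Corollary] [cite: Lange2023AbelianVarietiesComplex, §1.1.3 Cor. 1.1.19] -/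
theorem two_mul_finrank_degreeSpace_countingG_zero_inf_eigenspace_weylOperator_one (hη : ∀ v : E, v ≠ 0 → ∃ w : E, η ![v, w] ≠ 0) :
    2 * finrank ℂ ↥(degreeSpace (countingG E) 0 ⊓
        Module.End.eigenspace ((hasLefschetzProperty_lefschetzG hη).weylOperator isZGrading_countingG) 1) =
      (2 * finrank ℂ E).choose (finrank ℂ E) + 2 ^ finrank ℂ E := by
  have h1 := (hasLefschetzProperty_lefschetzG hη).two_mul_finrank_degreeSpace_zero_inf_eigenspace_weylOperator_one isZGrading_countingG
  rw [trace_weylOperator hη, finrank_degreeSpace_countingG_zero] at h1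
  exact_mod_cast h1

/-- **`2 dim (Hᵍ ∩ ker(w + 1)) + 2^g = C(2g, g)`**: the `w`-anti-invariant middle classes (`2 dim = dim Hᵍ − tr(w | Hᵍ)`, subtraction-free).
[cite: Serre1977, §2.6 Thm. 8 (ii) and Exercise 2.8 (a)] [cite: Beauville2010SL2, §3 Theorem and §5 Corollary] [cite: Lange2023AbelianVarietiesComplex, §1.1.3 Cor. 1.1.19] -/
theorem two_mul_finrank_degreeSpace_countingG_zero_inf_eigenspace_weylOperator_neg_one (hη : ∀ v : E, v ≠ 0 → ∃ w : E, η ![v, w] ≠ 0) :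
    2 * finrank ℂ ↥(degreeSpace (countingG E) 0 ⊓
        Module.End.eigenspace ((hasLefschetzProperty_lefschetzG hη).weylOperator isZGrading_countingG) (-1)) + 2 ^ finrank ℂ E =
      (2 * finrank ℂ E).choose (finrank ℂ E) := by
  have h1 := (hasLefschetzProperty_lefschetzG hη).two_mul_finrank_degreeSpace_zero_inf_eigenspace_weylOperator_neg_one isZGrading_countingG
  rw [trace_weylOperator hη, finrank_degreeSpace_countingG_zero, eq_sub_iff_add_eq] at h1
  exact_mod_cast h1

/-- `dim (Hᵍ ∩ ker(w − 1)) + dim (Hᵍ ∩ ker(w + 1)) = C(2g, g)` (`w | Hᵍ` is an involution). [cite: Serre1977, §2.6 Thm. 8 (i)]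
[cite: Lange2023AbelianVarietiesComplex, §1.1.3 Cor. 1.1.19] -/
theorem finrank_degreeSpace_countingG_zero_inf_eigenspace_weylOperator_one_add_neg_one (hη : ∀ v : E, v ≠ 0 → ∃ w : E, η ![v, w] ≠ 0) :
    finrank ℂ ↥(degreeSpace (countingG E) 0 ⊓ Module.End.eigenspace ((hasLefschetzProperty_lefschetzG hη).weylOperator isZGrading_countingG) 1) +
        finrank ℂ ↥(degreeSpace (countingG E) 0 ⊓
          Module.End.eigenspace ((hasLefschetzProperty_lefschetzG hη).weylOperator isZGrading_countingG) (-1)) =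
      (2 * finrank ℂ E).choose (finrank ℂ E) := by
  rw [(hasLefschetzProperty_lefschetzG hη).finrank_degreeSpace_zero_inf_eigenspace_weylOperator_one_add_neg_one isZGrading_countingG,
    finrank_degreeSpace_countingG_zero]

/-- `2^g ≤ C(2g, g)`, read off the Weyl element (`tr(w | Hᵍ) = 2^g ≤ dim Hᵍ` for an involution). [cite: Beauville2010SL2, §3 Theorem]
[cite: Lange2023AbelianVarietiesComplex, §1.1.3 Cor. 1.1.19] -/
theorem pow_le_choose_of_weylOperator (hη : ∀ v : E, v ≠ 0 → ∃ w : E, η ![v, w] ≠ 0) :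
    2 ^ finrank ℂ E ≤ (2 * finrank ℂ E).choose (finrank ℂ E) := by
  have h1 := two_mul_finrank_degreeSpace_countingG_zero_inf_eigenspace_weylOperator_neg_one hη
  omega

/-- **OFF THE MIDDLE DEGREE THE TWO REAL EIGENVALUES BALANCE**: `dim ker(w − 1) + dim (Hᵍ ∩ ker(w + 1)) = dim ker(w + 1) + dim (Hᵍ ∩ ker(w − 1))`
— on `Hᵏ ⊕ H^{2g−k}` (`k ≠ g`, `k ≡ g (2)`) the Weyl element swaps the two summands and is traceless (`dim ker(w ∓ 1) = 4^{g−1} ± 2^{g−1}`,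
`ComplexTorusWeilWeylOperatorEigenvalueMultiplicities`). [cite: Serre1977, §2.1 Exercise 2.2 and §2.6 Thm. 8 (ii)] [cite: Beauville2010SL2, §3 Theorem] -/
theorem finrank_eigenspace_weylOperator_one_add_eq (hη : ∀ v : E, v ≠ 0 → ∃ w : E, η ![v, w] ≠ 0) :
    finrank ℂ ↥(Module.End.eigenspace ((hasLefschetzProperty_lefschetzG hη).weylOperator isZGrading_countingG) 1) +
        finrank ℂ ↥(degreeSpace (countingG E) 0 ⊓
          Module.End.eigenspace ((hasLefschetzProperty_lefschetzG hη).weylOperator isZGrading_countingG) (-1)) =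
      finrank ℂ ↥(Module.End.eigenspace ((hasLefschetzProperty_lefschetzG hη).weylOperator isZGrading_countingG) (-1)) +
        finrank ℂ ↥(degreeSpace (countingG E) 0 ⊓
          Module.End.eigenspace ((hasLefschetzProperty_lefschetzG hη).weylOperator isZGrading_countingG) 1) := by
  have h1 := two_mul_finrank_degreeSpace_countingG_zero_inf_eigenspace_weylOperator_one hη
  have h2 := two_mul_finrank_degreeSpace_countingG_zero_inf_eigenspace_weylOperator_neg_one hη
  have h3 := finrank_eigenspace_weylOperator_one hη
  have h4 := finrank_eigenspace_weylOperator_neg_one hη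
  have h5 : 2 ^ (finrank ℂ E - 1) ≤ 4 ^ (finrank ℂ E - 1) := Nat.pow_le_pow_left (by norm_num) _
  have h6 : 2 ^ finrank ℂ E = 2 * 2 ^ (finrank ℂ E - 1) := by
    rw [← pow_succ', Nat.sub_add_cancel (finrank_pos (R := ℂ) (M := E))]
  omega

end ComplexTorus

end Literature.Geometry.Kaehler

end
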